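import Summits.Ventures.PercRepro.ProfileGapMonoThresholdNullityThreeFibre
import Summits.Ventures.PercRepro.ProfileGapMonoThresholdClassBound

/-!
# PercRepro — THE TOP THRESHOLD OF THE CO-RANK-`4` FAMILY HOLDS ON EVERY COLOOP-FREE MATROID OF NULLITY `3`
(p5, gen 31; `proofs/P5-GM1.md` §43(d),(f))

`#E = ρ(E) + 3`, co-rank `4`, threshold `ρ(E) − 1`.  With no `5`-point plane (else TopNuTwo), the excess form of
§40(c) reads `Σ_L ρ(E ∖ B) = Σ_L #(E ∖ cl B) + #𝔅` where `𝔅` is the set of deficient sets (demanding `3`-sets with a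
`4`-point plane), and three integer countings pay `#𝔅` from the boundary slack: every `B ∈ 𝔅` has at least
`C(ρ(E) − 2, 2)` transversal triples `Y` of its complement (ClassBound), `(B, Y) ↦ (Y ∪ p, p)` lands in the units
`(S, p)` — boundary targets with a coloop in the closure of the complement (NullityThree) — with fibres of size at most
`C(ρ(E) − 2, 2)` (NullityThreeFibre), and the units are counted by the boundary sum.  **`thresholdIneq_four_top_of_nullity_three`**
(`ρ(E) ≥ 4`, coloop-free; the `5`-point-plane case by `thresholdIneq_four_top_of_long_plane`).  Nothing open is asserted.
-/

open scoped Matroid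

namespace PercRepro.Cogirth

open Finset ThmH Skew Shadow Profile

variable {α : Type} [DecidableEq α] {N : Matroid α} [N.Finite]

/-- A loop lies in every closure. -/
theorem mem_clF_of_rk_singleton_eq_zero {p : α} (hp : p ∈ gr N) (h0 : rk N {p} = 0) {X : Finset α}
    (hX : X ⊆ gr N) : p ∈ clF N X := by
  rw [mem_clF_iff_rk_insert hp hX]
  exact rk_insert_of_loop hp h0 hX

/-- A coloop of a set is not a loop. -/
theorem rk_singleton_eq_one_of_mem_coloops {S : Finset α} (hS : S ⊆ gr N) {p : α} (hp : p ∈ coloops N S) :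
    rk N {p} = 1 := by
  obtain ⟨hpS, hpcl⟩ := mem_coloops.1 hp
  have h1 := rk_le_card' (M := N) {p}
  rw [card_singleton] at h1
  by_contra hne
  have h0 : rk N {p} = 0 := by omega
  exact hpcl (mem_clF_of_rk_singleton_eq_zero (hS hpS) h0 ((erase_subset p S).trans hS))

section Top

variable (hcf : ∀ z ∈ gr N, rk N ((gr N).erase z) = rk N (gr N)) (hn : (gr N).card = rk N (gr N) + 3)
  (hR : 4 ≤ rk N (gr N)) (hno : ∀ B ∈ Rq N 3, (clF N B).card + rk N (gr N) ≠ (gr N).card + 2)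

include hcf hn hR in
/-- **THE DEFICIENT SETS ARE PAID BY THE BOUNDARY UNITS** (nullity `3`, no `5`-point plane):
`#𝔅 ≤ Σ_{S boundary target} #(coloops(S) ∩ cl(E ∖ S))`. -/
theorem card_deficient_le_boundary_sum :
    (((Rq N 3).filter (fun B => rk N (gr N) - 1 + 1 ≤ rk N (gr N \ B))).filter
      (fun B => (clF N B).card = 4)).card ≤
    ∑ S ∈ (levelSetCoQ N (rk N (gr N) - 1) 4).filter (fun S => rk N (gr N \ S) = rk N (gr N) - 1),
      (coloops N S ∩ clF N (gr N \ S)).card := by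
  set R := rk N (gr N) with hRdef
  set 𝔅 := ((Rq N 3).filter (fun B => R - 1 + 1 ≤ rk N (gr N \ B))).filter (fun B => (clF N B).card = 4)
    with h𝔅def
  set Tb := (levelSetCoQ N (R - 1) 4).filter (fun S => rk N (gr N \ S) = R - 1) with hTbdef
  -- the facts about a deficient set
  have hdef : ∀ B ∈ 𝔅, B ∈ Rq N 3 ∧ rk N (gr N \ B) = R ∧ (clF N B).card = 4 := by
    intro B hB
    obtain ⟨hB1, hcl⟩ := mem_filter.1 hB
    obtain ⟨hBq, hBt⟩ := mem_filter.1 hB1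
    have := rk_mono' (M := N) (sdiff_subset : gr N \ B ⊆ gr N)
    exact ⟨hBq, by omega, hcl⟩
  -- the pairs (B, p, Y)
  set Pairs := 𝔅.sigma (fun B => (clF N B \ B).sigma (fun _ =>
    ((gr N \ clF N B).powersetCard 3).filter (fun Y => rk N (gr N \ Y) + 1 = R))) with hPairsdef
  set Units := Tb.sigma (fun S => coloops N S ∩ clF N (gr N \ S)) with hUnitsdef
  let f : (Σ _ : Finset α, Σ _ : α, Finset α) → (Σ _ : Finset α, α) := fun x => ⟨insert x.2.1 x.2.2, x.2.1⟩
  -- (1) the class bound: C(R − 2, 2) · #𝔅 ≤ #Pairs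
  have hP : (R - 2).choose 2 * 𝔅.card ≤ Pairs.card := by
    rw [hPairsdef, card_sigma]
    have : ∀ B ∈ 𝔅, (R - 2).choose 2 ≤ ((clF N B \ B).sigma (fun _ =>
        ((gr N \ clF N B).powersetCard 3).filter (fun Y => rk N (gr N \ Y) + 1 = R))).card := by
      intro B hB
      obtain ⟨hBq, hBsp, hcl⟩ := hdef B hB
      rw [card_sigma, sum_const, smul_eq_mul]
      have hB3 : B.card = 3 := (card_eq_three_of_nullity_three hn hBq hBsp).1
      have hclB : (clF N B \ B).card = 1 := by
        have := card_sdiff_add_card_eq_card (subset_clF (mem_Rq.1 hBq).1 : B ⊆ clF N B)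
        omega
      rw [hclB, one_mul]
      have hF : (clF N B).card + rk N (gr N) = (gr N).card + (4 - 3) := by omega
      have hO : (gr N \ clF N B).card = R - 1 := by
        have := card_sdiff_add_card_eq_card (clF_subset_gr (M := N) B)
        omega
      have := card_transversal_triples_ge hcf hBq hF (by norm_num) hR
      rw [hO] at this
      exact this
    calc (R - 2).choose 2 * 𝔅.card = ∑ _B ∈ 𝔅, (R - 2).choose 2 := by rw [sum_const, smul_eq_mul, mul_comm]
      _ ≤ _ := sum_le_sum this
  -- (2) the map into the units
  have hfmem : ∀ x ∈ Pairs, f x ∈ Units := by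
    rintro ⟨B, p, Y⟩ hx
    obtain ⟨hB, hpY⟩ := mem_sigma.1 hx
    obtain ⟨hp, hY⟩ := mem_sigma.1 hpY
    simp only at hp hY
    obtain ⟨hBq, hBsp, hcl⟩ := hdef B hB
    obtain ⟨hpcl, hpB⟩ := mem_sdiff.1 hp
    obtain ⟨hYp, hYco⟩ := mem_filter.1 hY
    obtain ⟨hYO, hYc⟩ := mem_powersetCard.1 hYp
    obtain ⟨hSmem, hpunit⟩ := unit_of_nullity_three hn hBq hBsp hpcl hpB hYO hYc hYco
    have hSb : rk N (gr N \ insert p Y) + 1 = R := rk_sdiff_insert_add_one (q := 4) hBq hYO hYco hpcl hpB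
    have hSb' : rk N (gr N \ insert p Y) = R - 1 := by omega
    exact mem_sigma.2 ⟨mem_filter.2 ⟨hSmem, hSb'⟩, hpunit⟩
  have himg : Pairs.image f ⊆ Units := image_subset_iff.2 hfmem
  -- (3) the fibre bound
  have hfib : ∀ u ∈ Pairs.image f, (Pairs.filter (fun x => f x = u)).card ≤ (R - 2).choose 2 := by
    intro u hu
    have hu' : u ∈ Units := himg hu
    obtain ⟨S, p⟩ := u
    obtain ⟨hS, hp⟩ := mem_sigma.1 hu'
    simp only at hS hp
    obtain ⟨hSmem, hSb⟩ := mem_filter.1 hS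
    have hSg : S ⊆ gr N := (mem_levelSetCoQ.1 hSmem).1.1
    obtain ⟨hpco, hpcl⟩ := mem_inter.1 hp
    have hpS : p ∈ S := (mem_coloops.1 hpco).1
    have hp1 : rk N {p} = 1 := rk_singleton_eq_one_of_mem_coloops hSg hpco
    have hSb' : rk N (gr N \ S) + 1 = rk N (gr N) := by omega
    have hclaim := card_claimants_le hn hR hSmem hSb' hpS hp1 hpcl
    refine le_trans ?_ hclaim
    -- the fibre injects into the claimants via x ↦ x.1
    refine card_le_card_of_injOn (fun x => x.1) ?_ ?_
    · rintro ⟨B, p', Y⟩ hx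
      obtain ⟨hxP, hfx⟩ := mem_filter.1 hx
      simp only [f, Sigma.mk.injEq] at hfx
      obtain ⟨hSeq, hpeq⟩ := hfx
      have hpeq' : p' = p := eq_of_heq hpeq
      subst hpeq'
      obtain ⟨hB, hpY⟩ := mem_sigma.1 hxP
      obtain ⟨hp', hY⟩ := mem_sigma.1 hpY
      simp only at hp' hY
      obtain ⟨hBq, hBsp, hcl⟩ := hdef B hB
      obtain ⟨hp'cl, hp'B⟩ := mem_sdiff.1 hp'
      obtain ⟨hYp, _⟩ := mem_filter.1 hY
      obtain ⟨hYO, _⟩ := mem_powersetCard.1 hYp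
      refine mem_filter.2 ⟨hBq, hBsp, hcl, hp'cl, ?_⟩
      rw [← hSeq]
      ext w
      simp only [mem_inter, mem_insert, notMem_empty, iff_false, not_and, not_or]
      intro hwB
      refine ⟨fun h => hp'B (h ▸ hwB), fun hwY => ?_⟩
      exact (mem_sdiff.1 (hYO hwY)).2 (subset_clF (mem_Rq.1 hBq).1 hwB)
    · rintro ⟨B₁, p₁, Y₁⟩ hx₁ ⟨B₂, p₂, Y₂⟩ hx₂ heq
      simp only at heq
      obtain ⟨hxP₁, hfx₁⟩ := mem_filter.1 hx₁
      obtain ⟨hxP₂, hfx₂⟩ := mem_filter.1 hx₂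
      simp only [f, Sigma.mk.injEq] at hfx₁ hfx₂
      obtain ⟨hS₁, hp₁⟩ := hfx₁
      obtain ⟨hS₂, hp₂⟩ := hfx₂
      have hp12 : p₁ = p₂ := (eq_of_heq hp₁).trans (eq_of_heq hp₂).symm
      have hpY₁ : p₁ ∉ Y₁ := by
        obtain ⟨_, hpY⟩ := mem_sigma.1 hxP₁
        obtain ⟨hp', hY⟩ := mem_sigma.1 hpY
        simp only at hp' hY
        intro h
        exact (mem_sdiff.1 ((mem_powersetCard.1 (mem_filter.1 hY).1).1 h)).2 (mem_sdiff.1 hp').1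
      have hpY₂ : p₂ ∉ Y₂ := by
        obtain ⟨_, hpY⟩ := mem_sigma.1 hxP₂
        obtain ⟨hp', hY⟩ := mem_sigma.1 hpY
        simp only at hp' hY
        intro h
        exact (mem_sdiff.1 ((mem_powersetCard.1 (mem_filter.1 hY).1).1 h)).2 (mem_sdiff.1 hp').1
      have hY : Y₁ = Y₂ := by
        have h : (insert p₁ Y₁).erase p₂ = (insert p₂ Y₂).erase p₂ := by rw [hS₁.trans hS₂.symm]
        rw [← hp12, erase_insert hpY₁, hp12, erase_insert hpY₂] at h
        exact h
      rw [heq, hp12, hY]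
  -- (4) assemble
  have hPU : Pairs.card ≤ (R - 2).choose 2 * Units.card :=
    (card_le_mul_card_image Pairs _ hfib).trans (Nat.mul_le_mul_left _ (card_le_card himg))
  have hpos : 1 ≤ (R - 2).choose 2 := Nat.choose_pos (by omega)
  have hBU : 𝔅.card ≤ Units.card := by
    by_contra hlt
    have : (R - 2).choose 2 * Units.card < (R - 2).choose 2 * 𝔅.card :=
      Nat.mul_lt_mul_of_pos_left (by omega) hpos
    omega
  rw [hUnitsdef, card_sigma] at hBU
  exact hBU

include hcf hn hR hno in
/-- **THE TOP THRESHOLD AT NULLITY `3` WITHOUT A `5`-POINT PLANE**: `ThresholdIneq N 4 (ρ(E) − 1)`. -/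
theorem thresholdIneq_four_top_of_nullity_three_of_no_five :
    ThresholdIneq N 4 (rk N (gr N) - 1) := by
  rw [thresholdIneq_iff_excess_boundary (by norm_num)]
  have hL : ∀ B ∈ (Rq N (4 - 1)).filter (fun B => rk N (gr N) - 1 + 1 ≤ rk N (gr N \ B)),
      B ∈ Rq N 3 ∧ rk N (gr N \ B) = rk N (gr N) ∧ B.card = 3 ∧
      ((clF N B).card = 3 ∨ (clF N B).card = 4) := by
    intro B hB
    obtain ⟨hBq, hBt⟩ := mem_filter.1 hB
    have hBq' : B ∈ Rq N 3 := hBq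
    have hmono := rk_mono' (M := N) (sdiff_subset : gr N \ B ⊆ gr N)
    have hBsp : rk N (gr N \ B) = rk N (gr N) := by omega
    have hB3 := (card_eq_three_of_nullity_three hn hBq' hBsp).1
    have hle5 := card_clF_le_five_of_coloopFree hn hcf hR hBq' hBsp
    have hne5 := hno B hBq'
    have hge3 : 3 ≤ (clF N B).card := hB3 ▸ card_le_card (subset_clF (mem_Rq.1 hBq').1)
    refine ⟨hBq', hBsp, hB3, ?_⟩
    omega
  -- the left side is R · #L, the first right sum is R · #L − #𝔅
  have hleft : ∑ B ∈ (Rq N (4 - 1)).filter (fun B => rk N (gr N) - 1 + 1 ≤ rk N (gr N \ B)), rk N (gr N \ B) =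
      ∑ _B ∈ (Rq N (4 - 1)).filter (fun B => rk N (gr N) - 1 + 1 ≤ rk N (gr N \ B)), rk N (gr N) :=
    sum_congr rfl (fun B hB => (hL B hB).2.1)
  have hright : ∑ B ∈ (Rq N (4 - 1)).filter (fun B => rk N (gr N) - 1 + 1 ≤ rk N (gr N \ B)), (gr N \ clF N B).card +
      (((Rq N (4 - 1)).filter (fun B => rk N (gr N) - 1 + 1 ≤ rk N (gr N \ B))).filter
        (fun B => (clF N B).card = 4)).card =
      ∑ _B ∈ (Rq N (4 - 1)).filter (fun B => rk N (gr N) - 1 + 1 ≤ rk N (gr N \ B)), rk N (gr N) := by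
    rw [card_filter, ← sum_add_distrib]
    refine sum_congr rfl (fun B hB => ?_)
    obtain ⟨hBq, _, _, hcl⟩ := hL B hB
    have := card_sdiff_add_card_eq_card (clF_subset_gr (M := N) B)
    split_ifs with h4
    · omega
    · rcases hcl with h3 | h4' <;> omega
  have hpay : (((Rq N (4 - 1)).filter (fun B => rk N (gr N) - 1 + 1 ≤ rk N (gr N \ B))).filter
        (fun B => (clF N B).card = 4)).card ≤
      ∑ S ∈ (levelSetCoQ N (rk N (gr N) - 1) 4).filter (fun S => rk N (gr N \ S) = rk N (gr N) - 1),
        (coloops N S ∩ clF N (gr N \ S)).card :=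
    card_deficient_le_boundary_sum hcf hn hR
  rw [hleft, ← hright]
  have hnonneg : 0 ≤ ∑ S ∈ levelSetCoQ N (rk N (gr N) - 1) 4, (4 - (coloops N S).card) := Nat.zero_le _
  omega

end Top

/-- **THE TOP THRESHOLD OF THE CO-RANK-`4` FAMILY HOLDS ON EVERY COLOOP-FREE MATROID OF NULLITY `3` AND RANK
`≥ 4`**: `#E = ρ(E) + 3` gives `ThresholdIneq N 4 (ρ(E) − 1)` — a `5`-point plane by TopNuTwo, otherwise by the
three countings above. -/
theorem thresholdIneq_four_top_of_nullity_three (hcf : ∀ z ∈ gr N, rk N ((gr N).erase z) = rk N (gr N))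
    (hn : (gr N).card = rk N (gr N) + 3) (hR : 4 ≤ rk N (gr N)) : ThresholdIneq N 4 (rk N (gr N) - 1) := by
  by_cases hex : ∃ B ∈ Rq N 3, (clF N B).card + rk N (gr N) = (gr N).card + 2
  · obtain ⟨B, hB, hl⟩ := hex
    exact thresholdIneq_four_top_of_long_plane hcf hB hl hR
  · exact thresholdIneq_four_top_of_nullity_three_of_no_five hcf hn hR
      (fun B hB heq => hex ⟨B, hB, heq⟩)

end PercRepro.Cogirth
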